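import Summits.QuantumFields.BalabanUV.Beta.SymRootedAveragingMatrix
import Summits.QuantumFields.BalabanUV.Beta.SymRootedDressingKernel

/-!
# `BalabanUV.Beta.CombRootedAbsorbsSym` — binder row D1, RULING R-D1-g35-1 (hR repair route (β) = CHART (III′)), brick B2 part **K4**:
# THE ROOTED COMB DRESSING ABSORBS THE ROOTED SYMMETRISED DRESSING AT THE SAME ROOT, `Π̂_c Π̂_s = Π̂_c`
# (`comp (trK (piK (ctr) N)) (trK (piKSym (ctr) N)) = trK (piK (ctr) N)` and its transpose), with the columns of `trK (piKSym (toSite r) N)`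
# and «`Π_ρ` IS REPRESENTED BY ITS MATRIX» (`hasSum_treeGaugeAt_delta1`, `hasSum_axProjAt_delta1`)

HONEST FRAMING (cell charter, verbatim): «discharging `BetaPertH` makes Bałaban's UV stability UNCONDITIONAL — a real constructive-QFT
result; it is NOT the continuum limit and NOT the Clay problem.»  HONEST DEPENDENCY (verbatim): «continuum YM on T⁴ ⇐ BetaPertH ∧ nine
spine estimates (0/9 proved); BetaPertH ⇐ (D1) ∧ (D4) ∧ CAP+tail; G-an2-4 gates asym, D1 and NE2/3/4.»  THIS MODULE DISCHARGES NOTHING of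
row D1 ∕ `BetaPertH`: [folklore] Form-level and kernel bookkeeping over OUR objects (`treeGaugeAt`, `axProjAt`, `symAxProjAt`, `symGaugeAt`, `piK`,
`piKSym`).  No `def`, no `def … : Prop`, nothing cited, 0 sorry.  K4 is ONE input of the owner's `RelInvBlindTransport.relInv_transport_of_blind`
(`hPS` at `P := trK (piK (ctr) Lc)`, `S := trK (piKSym (ctr) Lc)`; `hStPt` by the transpose); it does NOT prove P2, does NOT repair hR.
NOT D1, NOT BetaPertH, NOT continuum, NOT Clay.

ABSOLUTE RULE (cell, verbatim): «No internally-minted statement may enter as a cited fact. Every hypothesis is either kernel-proved in this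
package or a verbatim quotation of a PUBLISHED theorem with page reference.»

WHY (an3 g78 W-an3-g78-1 (V1)–(V2), memo `QAN2G351-AN3.v1.md`; owner an2 g35 AMEND1 l.36993).  `Π^{sym}_ρ A = A − grad g_A` with `g_A = symGaugeAt ρ A N`
ROOT-TRIVIAL (`symTreeGaugeAt_root`), and the rooted comb projector kills root-trivial pure gauges: `Π_ρ (grad g) = grad g − grad (g − g∘root) = 0`
(`axial_sum_grad`) — an3's farm-checked (B2-core) `axProjAt_symAxProjAt`, re-proved here and credited.  Kernel form: the field column of
`trK piK ∘ trK piKSym` at `(inl β, z)` is `Π_ρ` APPLIED TO the column `Π^{sym}_ρ δ_{(β,z)}` once `Π_ρ` is represented by its matrix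
(`hasSum_axProjAt_delta1`: ℝ-linearity of the rooted tree gauge over finite sums of scaled indicators — `BorderedHessian.treeGaugeAt_add'`,
`CompositeCorrectorLinear.treeGaugeAt_smul` — + hull locality `SymSliceBlockMatrix.axial_sum_congr_of_hull` + `ValueHessianBlind`-type support).
CONTENT: §1 `treeGaugeAt_congr`, **`hasSum_treeGaugeAt_delta1`**, **`hasSum_axProjAt_delta1`**, **`axProjAt_symAxProjAt`**; §2 columns of
`trK (piKSym (toSite r) N)`: `piKSym_inl_inl_eq_delta1`, `fcol_trK_piKSym_inl`, `summable_symGaugeAt_delta1`, `curv_symAxProjAt`, **`tsum_mul_piKSym_inl_inl`**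
(bounded co-closed rows reproduced), `comp_trK_piKSym_inr`, `sgnK_trK_piKSym`; §3 **`comp_trK_piK_trK_piKSym`**, **`comp_piKSym_piK`**, `comp_comp_axEc_piKSym_symEc` (the transposed weak range condition `hStEs`, `trK` of the owner's K3-weak).
Unit `b2b-balaban-beta-d1-formalise-leaf-03` gen 19 (D1 formalisation swarm), 2026-08-21; row-D1 owner `b2b-balaban-beta-an2`; B2 PART 1 (`piKSym`) = the owner.
-/

noncomputable section

open Finset
open scoped BigOperators Nat
open Literature.MathematicalPhysics.QuantumFieldTheory
open Literature.MathematicalPhysics.QuantumFieldTheory.Balaban1983to89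
open Literature.MathematicalPhysics.QuantumFieldTheory.Balaban1983to89.Beta
open ExpKernelCalculus (MKer comp)
open AffineAveraging (Form0 Form1 Site box toSite unitVec dz curv curvAdj codiff₁ curv_dz)
open AffineReproduction (curv_sub)
open AveragingContours (grad grad_eq_dz axial blk blk_block blk_add_off off off_mem_box axial_sum_grad axial_sum_sub)
open AveragingContoursRooted (ctr ctrOff ctrOff_mem_box treeGaugeAt)
open RootedComb (axProjAt axProjAt_apply treeGaugeAt_root)
open KKTFluctuationKernel (delta1 delta1_apply)
open KKTFluctuationEnergy (summable_mul_of_bdd summable_dz)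
open OneStepResolventKernel (Fib)
open Summit.QuantumFields.BalabanUV.Beta.TameKernelCalculus
open Summit.QuantumFields.BalabanUV.Beta.AxialDressingRooted (InHull piK piK_inl_inl piK_inl_inr piK_inr_inl piK_inr_inr trK_piK_comp_inr
  tsum_point' one_le_of_neZero axEc trK_axEc)
open Summit.QuantumFields.BalabanUV.Beta.SymSliceProjectorKernel (symEc trK_symEc)
open Summit.QuantumFields.BalabanUV.Beta.BorderedHessian (fcol fcol_apply sgnK sgnK_eq_self tsum_mul_dz_eq_zero_of_codiff₁ treeGaugeAt_add' treeGaugeAt_sub')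
open Summit.QuantumFields.BalabanUV.Beta.SymmetrisedAxialPotential
open Summit.QuantumFields.BalabanUV.Beta.SymmetrisedAxialGauge (symAxProjAt symTreeGaugeAt_root)
open Summit.QuantumFields.BalabanUV.Beta.SymmetrisedAxialGaugeBlockMean (symGaugeAt symAxProjAt_eq_sub)
open Summit.QuantumFields.BalabanUV.Beta.SymGaugeMultiplierBlockMean (bondIndR_eq_delta1)
open Summit.QuantumFields.BalabanUV.Beta.SymSliceBlockMatrix (axial_sum_congr_of_hull blk_eq_of_inHull)
open Summit.QuantumFields.BalabanUV.Beta.SymBorderedHessianStepBlind (symGaugeAt_delta1_eq_zero_of_blk_ne)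
open Summit.QuantumFields.BalabanUV.Beta.CompositeCorrectorLinear (treeGaugeAt_smul)
open Summit.QuantumFields.BalabanUV.Beta.SymRootedDressingKernel (piKSym piKSym_inl_inl piKSym_inl_inr piKSym_inr_inl piKSym_inr_inr
  piKSym_inl_inl_eq_symAxProjAt comp_symEc_comp_trK_piKSym_axEc)
open Summit.QuantumFields.BalabanUV.Beta.SymRootedAveragingMatrix (piK_inl_inl_eq)

namespace Summit.QuantumFields.BalabanUV.Beta.CombRootedAbsorbsSym

variable {d : ℕ}

/-! ## §1 Form level: the rooted tree gauge and `Π_ρ` are represented by their matrices; `Π_ρ Π^{sym}_ρ = Π_ρ` -/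

section FormLevel

variable {N : ℕ} {r : Fin (d + 1) → ℕ}

/-- [folklore] BLOCK LOCALITY of the rooted tree gauge (in-block root): it reads `A` only on the bonds of the block of `x`
(`SymSliceBlockMatrix.axial_sum_congr_of_hull` + `blk_eq_of_inHull`; twin of `symTreeGaugeAt_congr`). -/
theorem treeGaugeAt_congr (hN : 1 ≤ N) (hr : r ∈ box (d + 1) N) {A A' : Form1 (d + 1) ℝ} {x : Fin (d + 1) → ℤ}
    (h : ∀ κ z, blk N z = blk N x → blk N (z + unitVec κ) = blk N x → A κ z = A' κ z) :
    treeGaugeAt (toSite r) A N x = treeGaugeAt (toSite r) A' N x := by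
  unfold treeGaugeAt
  have hx : x = (N : ℤ) • blk N x + toSite (off N x) := (blk_add_off hN x).symm
  have key : ∀ x', x' = (N : ℤ) • blk N x + toSite (off N x) →
      (axial A ((N : ℤ) • blk N x + toSite r) x').sum = (axial A' ((N : ℤ) • blk N x + toSite r) x').sum := by
    intro x' hx'
    subst hx'
    apply axial_sum_congr_of_hull
    intro κ z hz hz'
    exact h κ z (blk_eq_of_inHull hN hr (off_mem_box hN x) hz) (blk_eq_of_inHull hN hr (off_mem_box hN x) hz')
  exact key x hx

/-- [folklore] **THE ROOTED TREE GAUGE IS REPRESENTED BY ITS MATRIX** (in-block root, `N ≥ 1`): for every fine 1-form `A`,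
`Σ'_w Σ_l treeGaugeAt ρ (δ_{(l,w)}) N x · A_l(w) = treeGaugeAt ρ A N x` (twin of `SymRootedAveragingMatrix.hasSum_symTreeGaugeAt_delta1`). -/
theorem hasSum_treeGaugeAt_delta1 (hN : 1 ≤ N) (hr : r ∈ box (d + 1) N) (A : Form1 (d + 1) ℝ) (x : Fin (d + 1) → ℤ) :
    HasSum (fun w : Fin (d + 1) → ℤ => ∑ l, treeGaugeAt (toSite r) (delta1 l w) N x * A l w) (treeGaugeAt (toSite r) A N x) := by
  classical
  set B : Finset (Fin (d + 1) → ℤ) := (box (d + 1) N).image fun b => (N : ℤ) • blk N x + toSite b with hB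
  have hmem : ∀ w, w ∈ B ↔ blk N w = blk N x := by
    intro w
    constructor
    · intro hw
      obtain ⟨b, hb, rfl⟩ := Finset.mem_image.1 hw
      exact blk_block (blk N x) hb
    · intro hw
      exact Finset.mem_image.2 ⟨off N w, off_mem_box hN w, by rw [← hw]; exact blk_add_off hN w⟩
  have hzeroF : ∀ y, treeGaugeAt (toSite r) (0 : Form1 (d + 1) ℝ) N y = 0 := by
    intro y
    have e := congrFun (treeGaugeAt_sub' (toSite r) (0 : Form1 (d + 1) ℝ) 0 N) y
    rw [sub_self, Pi.sub_apply, sub_self] at e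
    exact e
  have hsum : ∀ (s : Finset ((Fin (d + 1) → ℤ) × Fin (d + 1))) (F : (Fin (d + 1) → ℤ) × Fin (d + 1) → Form1 (d + 1) ℝ),
      treeGaugeAt (toSite r) (∑ p ∈ s, F p) N x = ∑ p ∈ s, treeGaugeAt (toSite r) (F p) N x := by
    intro s F
    induction s using Finset.induction_on with
    | empty => rw [Finset.sum_empty, Finset.sum_empty, hzeroF]
    | insert i s hi ih => rw [Finset.sum_insert hi, Finset.sum_insert hi, treeGaugeAt_add', Pi.add_apply, ih]
  set A' : Form1 (d + 1) ℝ := ∑ p ∈ B ×ˢ (Finset.univ : Finset (Fin (d + 1))), A p.2 p.1 • delta1 p.2 p.1 with hA'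
  have hA'ap : ∀ κ z, A' κ z = if z ∈ B then A κ z else 0 := by
    intro κ z
    rw [hA', Finset.sum_apply, Finset.sum_apply]
    have e : ∀ p : (Fin (d + 1) → ℤ) × Fin (d + 1), (A p.2 p.1 • delta1 p.2 p.1) κ z = if (z, κ) = p then A κ z else 0 := by
      rintro ⟨w, l⟩
      rw [Pi.smul_apply, Pi.smul_apply, smul_eq_mul, delta1_apply]
      by_cases h : (z, κ) = (w, l)
      · obtain ⟨rfl, rfl⟩ := Prod.mk.inj h
        rw [if_pos ⟨rfl, rfl⟩, if_pos rfl, mul_one]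
      · rw [if_neg h, if_neg, mul_zero]
        rintro ⟨hκ, hz⟩
        exact h (by rw [hκ, hz])
    simp_rw [e]
    rw [Finset.sum_ite_eq]
    simp only [Finset.mem_product, Finset.mem_univ, and_true]
  have hcongr : treeGaugeAt (toSite r) A N x = treeGaugeAt (toSite r) A' N x :=
    treeGaugeAt_congr hN hr fun κ z hz _ => by rw [hA'ap, if_pos ((hmem z).2 hz)]
  have hzero : ∀ w ∉ B, ∑ l, treeGaugeAt (toSite r) (delta1 l w) N x * A l w = 0 := by
    intro w hw
    refine Finset.sum_eq_zero fun l _ => ?_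
    have h0 : treeGaugeAt (toSite r) (delta1 l w) N x = treeGaugeAt (toSite r) (0 : Form1 (d + 1) ℝ) N x :=
      treeGaugeAt_congr hN hr fun κ z hz _ => by
        rw [delta1_apply, Pi.zero_apply, Pi.zero_apply, if_neg]
        rintro ⟨-, hzw⟩
        rw [hzw] at hz
        exact hw ((hmem w).2 hz)
    rw [h0, hzeroF, zero_mul]
  have hval : ∑ w ∈ B, ∑ l, treeGaugeAt (toSite r) (delta1 l w) N x * A l w = treeGaugeAt (toSite r) A N x := by
    rw [hcongr, hA', hsum, Finset.sum_product]
    refine Finset.sum_congr rfl fun w _ => Finset.sum_congr rfl fun l _ => ?_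
    rw [treeGaugeAt_smul, mul_comm]
  rw [← hval]
  exact hasSum_sum_of_ne_finset_zero hzero

/-- [folklore] **THE ROOTED COMB PROJECTOR `Π_ρ` IS REPRESENTED BY ITS MATRIX**: for every fine 1-form `A`,
`Σ'_w Σ_l (Π_ρ δ_{(l,w)})_κ(x) · A_l(w) = (Π_ρ A)_κ(x)` (`axProjAt_apply` + `hasSum_treeGaugeAt_delta1` at `x` and `x + e_κ`). -/
theorem hasSum_axProjAt_delta1 (hN : 1 ≤ N) (hr : r ∈ box (d + 1) N) (A : Form1 (d + 1) ℝ) (κ : Fin (d + 1))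
    (x : Fin (d + 1) → ℤ) :
    HasSum (fun w : Fin (d + 1) → ℤ => ∑ l, axProjAt (toSite r) N (delta1 l w) κ x * A l w) (axProjAt (toSite r) N A κ x) := by
  have hδ : HasSum (fun w : Fin (d + 1) → ℤ => ∑ l, delta1 l w κ x * A l w) (A κ x) := by
    have e : (fun w : Fin (d + 1) → ℤ => ∑ l, delta1 l w κ x * A l w) = fun w => if w = x then A κ x else 0 := by
      funext w
      by_cases hw : w = x
      · subst hw
        rw [if_pos rfl, Finset.sum_eq_single κ (fun l _ hl => by rw [delta1_apply, if_neg (fun h => hl h.1.symm), zero_mul])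
          (fun h => (h (Finset.mem_univ κ)).elim), delta1_apply, if_pos ⟨rfl, rfl⟩, one_mul]
      · rw [if_neg hw]
        exact Finset.sum_eq_zero fun l _ => by rw [delta1_apply, if_neg (fun h => hw h.2.symm), zero_mul]
    rw [e]
    exact hasSum_ite_eq x (A κ x)
  have h := hδ.sub ((hasSum_treeGaugeAt_delta1 hN hr A (x + unitVec κ)).sub (hasSum_treeGaugeAt_delta1 hN hr A x))
  have hfun : (fun w : Fin (d + 1) → ℤ => ∑ l, axProjAt (toSite r) N (delta1 l w) κ x * A l w)
      = fun w => (∑ l, delta1 l w κ x * A l w)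
        - ((∑ l, treeGaugeAt (toSite r) (delta1 l w) N (x + unitVec κ) * A l w) - ∑ l, treeGaugeAt (toSite r) (delta1 l w) N x * A l w) := by
    funext w
    simp only [axProjAt_apply, sub_mul, Finset.sum_sub_distrib]
  rw [axProjAt_apply, hfun]
  exact h

/-- [folklore] **`Π_ρ ∘ Π^{sym}_ρ = Π_ρ` AT THE SAME IN-BLOCK ROOT** (an3 g78's farm-checked (B2-core), re-proved): the rooted comb projector kills the
ROOT-TRIVIAL pure gauge `grad (symGaugeAt ρ A N)` (it vanishes at every block root, `symTreeGaugeAt_root`). -/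
theorem axProjAt_symAxProjAt (hr : r ∈ box (d + 1) N) (A : Form1 (d + 1) ℝ) :
    axProjAt (toSite r) N (symAxProjAt (toSite r) N A) = axProjAt (toSite r) N A := by
  set g : Form0 (d + 1) ℝ := symGaugeAt (toSite r) A N with hg
  have hgroot : ∀ z : Fin (d + 1) → ℤ, g ((N : ℤ) • blk N z + toSite r) = 0 := fun z => by
    simp only [hg, symGaugeAt, symTreeGaugeAt_root hr A (blk N z), mul_zero]
  have hs : symAxProjAt (toSite r) N A = A - grad g := symAxProjAt_eq_sub _ _ _
  have htg : ∀ (f : Form0 (d + 1) ℝ) (x : Fin (d + 1) → ℤ),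
      treeGaugeAt (toSite r) (grad f) N x = f x - f ((N : ℤ) • blk N x + toSite r) := fun f x => axial_sum_grad f _ x
  funext κ x
  rw [hs, axProjAt_apply, axProjAt_apply]
  have h1 : treeGaugeAt (toSite r) (A - grad g) N (x + unitVec κ)
      = treeGaugeAt (toSite r) A N (x + unitVec κ) - treeGaugeAt (toSite r) (grad g) N (x + unitVec κ) := axial_sum_sub A (grad g) _ _
  have h2 : treeGaugeAt (toSite r) (A - grad g) N x
      = treeGaugeAt (toSite r) A N x - treeGaugeAt (toSite r) (grad g) N x := axial_sum_sub A (grad g) _ _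
  rw [h1, h2, htg, htg, hgroot, hgroot]
  simp only [Pi.sub_apply, grad]
  ring

end FormLevel

/-! ## §2 The columns of the rooted symmetrised dressing `trK (piKSym (toSite r) N)` -/

section Columns

variable {N : ℕ} {r : Fin (d + 1) → ℕ}

/-- [folklore] The (unwindowed) field–field entry of `piKSym` is the rooted symmetrised projector of the bond indicator `δ_{(β,z)}` (the owner's
`piKSym_inl_inl_eq_symAxProjAt` + `bondIndR_eq_delta1`). -/
theorem piKSym_inl_inl_eq_delta1 (hN : 1 ≤ N) (hr : r ∈ box (d + 1) N) (z y : Fin (d + 1) → ℤ) (β l : Fin (d + 1)) :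
    piKSym (toSite r) N z y (Sum.inl β) (Sum.inl l) = symAxProjAt (toSite r) N (delta1 β z) l y := by
  rw [piKSym_inl_inl_eq_symAxProjAt hN hr, bondIndR_eq_delta1]

/-- [folklore] **THE FIELD COLUMN OF `trK piKSym` AT `(inl β, z)` IS `Π^{sym}_ρ δ_{(β,z)}`.** -/
theorem fcol_trK_piKSym_inl (hN : 1 ≤ N) (hr : r ∈ box (d + 1) N) (z : Fin (d + 1) → ℤ) (β : Fin (d + 1)) :
    fcol (trK (piKSym (toSite r) N)) z (Sum.inl β) = symAxProjAt (toSite r) N (delta1 β z) := by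
  funext l y
  rw [fcol_apply, trK_apply, piKSym_inl_inl_eq_delta1 hN hr]

/-- [folklore] The symmetrised gauge parameter of a bond indicator is summable (it lives in the bond's block, `symGaugeAt_delta1_eq_zero_of_blk_ne`). -/
theorem summable_symGaugeAt_delta1 (hN : 1 ≤ N) (hr : r ∈ box (d + 1) N) (β : Fin (d + 1)) (z : Fin (d + 1) → ℤ) :
    Summable (symGaugeAt (toSite r) (delta1 β z) N) := by
  classical
  refine summable_of_ne_finset_zero (s := (box (d + 1) N).image fun b => (N : ℤ) • blk N z + toSite b) fun p hp => ?_
  apply symGaugeAt_delta1_eq_zero_of_blk_ne hN hr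
  intro hblk
  refine hp (Finset.mem_image.2 ⟨off N p, off_mem_box hN p, ?_⟩)
  rw [← hblk]
  exact blk_add_off hN p

/-- [folklore] `curv (Π^{sym}_ρ A) = curv A`: the rooted symmetrised dressing is a gradient correction, killed by `curv`. -/
theorem curv_symAxProjAt (ρ : Site (d + 1)) (N : ℕ) (A : Form1 (d + 1) ℝ) : curv (symAxProjAt ρ N A) = curv A := by
  rw [symAxProjAt_eq_sub, curv_sub, grad_eq_dz, curv_dz, sub_zero]

/-- [folklore] **REPRODUCTION OF A BOUNDED CO-CLOSED ROW BY THE FIELD BLOCK OF `trK piKSym`** (in-block root; twin of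
`SymRootedAveragingMatrix.tsum_mul_piK_inl_inl`): `Σ'_y Σ_l A_l(y) · piKSym ρ N z y (inl β) (inl l) = A_β(z)`. -/
theorem tsum_mul_piKSym_inl_inl (hN : 1 ≤ N) (hr : r ∈ box (d + 1) N) {A : Form1 (d + 1) ℝ} {C : ℝ}
    (hA : ∀ l y, |A l y| ≤ C) (hco : codiff₁ A = 0) (z : Fin (d + 1) → ℤ) (β : Fin (d + 1)) :
    ∑' y, ∑ l, A l y * piKSym (toSite r) N z y (Sum.inl β) (Sum.inl l) = A β z := by
  have e : ∀ (y : Fin (d + 1) → ℤ) (l : Fin (d + 1)), piKSym (toSite r) N z y (Sum.inl β) (Sum.inl l) =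
      delta1 β z l y - dz (symGaugeAt (toSite r) (delta1 β z) N) l y := by
    intro y l
    rw [piKSym_inl_inl_eq_delta1 hN hr, symAxProjAt_eq_sub, grad_eq_dz]
    rfl
  simp_rw [e, mul_sub, Finset.sum_sub_distrib]
  have hδ : ∀ y, y ≠ z → ∑ l, A l y * delta1 β z l y = 0 := fun y hy =>
    Finset.sum_eq_zero fun l _ => by rw [delta1_apply, if_neg (fun h => hy h.2), mul_zero]
  have hs1 : Summable fun y => ∑ l, A l y * delta1 β z l y :=
    summable_of_ne_finset_zero (s := {z}) fun y hy => hδ y (by rwa [Finset.mem_singleton] at hy)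
  have hg := summable_symGaugeAt_delta1 hN hr β z
  have hs2 : Summable fun y => ∑ l, A l y * dz (symGaugeAt (toSite r) (delta1 β z) N) l y :=
    summable_sum fun l _ => summable_mul_of_bdd (hA l) (summable_dz hg l)
  rw [hs1.tsum_sub hs2, tsum_mul_dz_eq_zero_of_codiff₁ hA hco hg, sub_zero, tsum_eq_single z hδ,
    Finset.sum_eq_single β (fun l _ hl => by rw [delta1_apply, if_neg (fun h => hl h.1), mul_zero])
      (fun h => (h (Finset.mem_univ β)).elim),
    delta1_apply, if_pos ⟨rfl, rfl⟩, mul_one]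

/-- [folklore] Right composition with `trK piKSym` does not touch a MULTIPLIER column. -/
theorem comp_trK_piKSym_inr (ρ : Fin (d + 1) → ℤ) (N : ℕ) (A : MKer (d + 1) (Fib d)) (x z : Fin (d + 1) → ℤ) (a : Fib d)
    (μ : Fin (d + 1)) : comp A (trK (piKSym ρ N)) x z a (Sum.inr μ) = A x z a (Sum.inr μ) := by
  unfold ExpKernelCalculus.comp
  have h : ∀ y, ∑ f : Fib d, A x y a f * trK (piKSym ρ N) y z f (Sum.inr μ) = if y = z then A x y a (Sum.inr μ) else 0 := by
    intro y
    rw [Fintype.sum_sum_type]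
    simp only [trK_apply, piKSym_inr_inl, mul_zero, Finset.sum_const_zero, zero_add, piKSym_inr_inr]
    by_cases hy : y = z
    · subst hy
      simp
    · simp [hy, Ne.symm hy]
  simp_rw [h]
  exact tsum_point' z _

/-- [folklore] `piKSym` has vanishing mixed blocks, so `sgnK` fixes its transpose. -/
theorem sgnK_trK_piKSym (ρ : Fin (d + 1) → ℤ) (N : ℕ) : sgnK (trK (piKSym ρ N)) = trK (piKSym (d := d) ρ N) :=
  sgnK_eq_self (fun x y κ l => by rw [trK_apply, piKSym_inr_inl]) (fun x y κ l => by rw [trK_apply, piKSym_inl_inr])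

end Columns

/-! ## §3 The rooted comb dressing absorbs the rooted symmetrised dressing: `Π̂_c Π̂_s = Π̂_c` -/

section Absorb

variable {N : ℕ}

/-- [folklore] **K4: `comp (trK (piK (ctr (d+1) N) N)) (trK (piKSym (ctr (d+1) N) N)) = trK (piK (ctr (d+1) N) N)`** — the hypothesis `hPS` of
`RelInvBlindTransport.relInv_transport_of_blind` at `P := trK (piK (ctr) N)`, `S := trK (piKSym (ctr) N)`.  Field columns: `Π_ρ` applied to the column
`Π^{sym}_ρ δ_{(β,z)}` (`hasSum_axProjAt_delta1`) is `Π_ρ δ_{(β,z)}` (`axProjAt_symAxProjAt`); multiplier rows ∕ columns are identities. -/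
theorem comp_trK_piK_trK_piKSym [NeZero N] :
    comp (trK (piK (ctr (d + 1) N) N)) (trK (piKSym (ctr (d + 1) N) N)) = trK (piK (d := d) (ctr (d + 1) N) N) := by
  have hN : 1 ≤ N := one_le_of_neZero N
  have hr : ctrOff (d + 1) N ∈ box (d + 1) N := ctrOff_mem_box hN
  rw [show ctr (d + 1) N = toSite (ctrOff (d + 1) N) from rfl]
  funext x z a b
  rcases b with β | μ
  · rcases a with κ | m
    · unfold ExpKernelCalculus.comp
      have e : ∀ y, ∑ f : Fib d, trK (piK (toSite (ctrOff (d + 1) N)) N) x y (Sum.inl κ) f * trK (piKSym (toSite (ctrOff (d + 1) N)) N) y z f (Sum.inl β)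
          = ∑ l : Fin (d + 1), axProjAt (toSite (ctrOff (d + 1) N)) N (delta1 l y) κ x * symAxProjAt (toSite (ctrOff (d + 1) N)) N (delta1 β z) l y := by
        intro y
        rw [Fintype.sum_sum_type]
        simp only [trK_apply, piK_inr_inl, zero_mul, Finset.sum_const_zero, add_zero, piK_inl_inl_eq hN hr, piKSym_inl_inl_eq_delta1 hN hr]
      simp_rw [e]
      rw [(hasSum_axProjAt_delta1 hN hr (symAxProjAt (toSite (ctrOff (d + 1) N)) N (delta1 β z)) κ x).tsum_eq, axProjAt_symAxProjAt hr,
        trK_apply, piK_inl_inl_eq hN hr]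
    · rw [trK_piK_comp_inr, trK_apply, trK_apply, piKSym_inl_inr, piK_inl_inr]
  · exact comp_trK_piKSym_inr _ _ _ _ _ _ _

/-- [folklore] **K4, TRANSPOSED: `comp (piKSym (ctr (d+1) N) N) (piK (ctr (d+1) N) N) = piK (ctr (d+1) N) N`** — the hypothesis `hStPt` at
`St := piKSym (ctr) N`, `Pt := piK (ctr) N` (by `trK_comp`). -/
theorem comp_piKSym_piK [NeZero N] :
    comp (piKSym (ctr (d + 1) N) N) (piK (ctr (d + 1) N) N) = piK (d := d) (ctr (d + 1) N) N := by
  have h : trK (comp (piKSym (ctr (d + 1) N) N) (piK (ctr (d + 1) N) N)) = trK (piK (d := d) (ctr (d + 1) N) N) := by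
    rw [trK_comp, comp_trK_piK_trK_piKSym]
  have h' := congrArg trK h
  rwa [trK_trK, trK_trK] at h'

/-- [folklore] THE TRANSPOSED WEAK RANGE CONDITION (the hypothesis `hStEs` of `RelInvBlindTransport.relInv_transport_of_blind` at `St := piKSym (ctr) N`,
`Es := symEc N`, `Ec := axEc (ctr) N`): `comp (comp (axEc (ctr) N) (piKSym (ctr) N)) (symEc N) = comp (axEc (ctr) N) (piKSym (ctr) N)` — the `trK` of the
owner's `SymRootedDressingKernel.comp_symEc_comp_trK_piKSym_axEc` (`trK_axEc`, `trK_symEc`). -/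
theorem comp_comp_axEc_piKSym_symEc [NeZero N] :
    comp (comp (axEc (ctr (d + 1) N) N) (piKSym (ctr (d + 1) N) N)) (symEc N) = comp (axEc (ctr (d + 1) N) N) (piKSym (d := d) (ctr (d + 1) N) N) := by
  have h := congrArg trK (comp_symEc_comp_trK_piKSym_axEc (d := d) (one_le_of_neZero N))
  simp only [trK_comp, trK_trK, trK_axEc, trK_symEc] at h
  exact h

end Absorb

end Summit.QuantumFields.BalabanUV.Beta.CombRootedAbsorbsSym

end
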